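import Mathlib
import HarnessLib.Audit
import Summits.PneNP.PneNP.Theorems.ClusOshDown

/-!
# Route ClusUniversalCertificate — F1(c): complement duality of the colex-standard sets (osh-P2.md §2)
(rung F-N1, cell pnp-ideate, crux `UniversalCertAll` = stmt-PneNP-19683; planner p1 g14, `lines/osh-P2.md` F1(c) "osh(V ∖ Y) = {T : [M]∖T ∉ osh(Y)}
(induction on (b): the complement swaps U ↔ V'∖I); hence S(V∖Y) = S(Y) + M·2^{M−1} − M|Y|"; restricted-model combinatorics — nothing here bears on `P` versus `NP`)

* `proj_compl`, `dbl_compl` — complementing `Y` swaps projection and double fibres: `U(Yᶜ) = I(Y)ᶜ`, `I(Yᶜ) = U(Y)ᶜ`;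
* `colexStd_compl` — **`T` is standard for `V ∖ Y` iff `Tᶜ` is NOT standard for `Y`**;
* `oshS_compl` — **`S(V ∖ Y) + N·|Y| = S(Y) + N·2^{N−1}`** (subtraction-free form).
-/

set_option linter.dupNamespace false -- `Summit.PneNP.PneNP.…`: summit = sub-problem name (D-0017 single-conjunct layout)

namespace Summit.PneNP.PneNP.Theorems.ClusHilbert.Osh

open Finset
open Summit.PneNP.PneNP.Theorems.ClusCube (V)

variable {N : ℕ}

/-! ## Complements and the split -/

/-- `U(Yᶜ) = I(Y)ᶜ`. -/
theorem proj_compl (Y : Finset (V (N + 1))) : proj Yᶜ = (dbl Y)ᶜ := by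
  ext w
  unfold proj
  simp only [mem_union, mem_lvl, mem_compl, mem_dbl]
  tauto

/-- `I(Yᶜ) = U(Y)ᶜ`. -/
theorem dbl_compl (Y : Finset (V (N + 1))) : dbl Yᶜ = (proj Y)ᶜ := by
  ext w
  unfold proj
  simp only [mem_union, mem_lvl, mem_compl, mem_dbl]
  tauto

/-- Complement of an embedded set. -/
theorem compl_emb (S : Finset (Fin N)) : (emb S)ᶜ = insert (Fin.last N) (emb Sᶜ) := by
  ext a
  rw [mem_compl, mem_insert]
  induction a using Fin.lastCases with
  | last =>
    simp only [last_notMem_emb, not_false_eq_true, true_or]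
  | cast i =>
    unfold emb
    simp only [mem_image, not_exists, not_and, (Fin.castSucc_lt_last i).ne, false_or, mem_compl]
    constructor
    · intro h; exact ⟨i, fun hi => h i hi rfl, rfl⟩
    · rintro ⟨j, hj, hji⟩ k hk hki
      have h1 := Fin.castSucc_injective N hji
      have h2 := Fin.castSucc_injective N hki
      subst h1; subst h2
      exact hj hk

/-- Complement of an embedded set plus the last coordinate. -/
theorem compl_insert_emb (S : Finset (Fin N)) : (insert (Fin.last N) (emb S))ᶜ = emb Sᶜ := by
  rw [← compl_compl (emb Sᶜ), compl_emb, compl_compl]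

/-! ## F1(c) -/

/-- **F1(c): `T` is colex-standard for `V ∖ Y` iff `Tᶜ` is not colex-standard for `Y`.** -/
theorem colexStd_compl : ∀ (N : ℕ) (Y : Finset (V N)) (T : Finset (Fin N)), colexStd Yᶜ T ↔ ¬ colexStd Y Tᶜ := by
  intro N
  induction N with
  | zero =>
    intro Y T
    have hT : T = ∅ := eq_empty_of_forall_notMem fun i _ => i.elim0
    subst hT
    have hTc : (∅ : Finset (Fin 0))ᶜ = ∅ := eq_empty_of_forall_notMem fun i _ => i.elim0
    rw [hTc, colexStd_empty_iff, colexStd_empty_iff]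
    -- `V 0` is a single point
    have hsub : ∀ y : V 0, y = fun i => i.elim0 := fun y => funext fun i => i.elim0
    constructor
    · rintro ⟨y, hy⟩ ⟨y', hy'⟩
      rw [mem_compl, hsub y, ← hsub y'] at hy
      exact hy hy'
    · intro h
      refine ⟨fun i => i.elim0, mem_compl.2 fun hy => h ⟨_, hy⟩⟩
  | succ N ih =>
    intro Y T
    by_cases hl : Fin.last N ∈ T
    · have hT : T = insert (Fin.last N) (emb (cut (T.erase (Fin.last N)))) := by
        rw [emb_cut (fun h => (mem_erase.1 h).1 rfl), insert_erase hl]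
      rw [hT, colexStd_insert, dbl_compl, ih, compl_insert_emb, colexStd_emb]
    · have hT : T = emb (cut T) := (emb_cut hl).symm
      rw [hT, colexStd_emb, proj_compl, ih, compl_emb, colexStd_insert]

/-! ## The degree sum of the complement -/

/-- `Σ_{T ⊆ [N]} |T| = N · 2^{N−1}` (as `2 · Σ = N · 2^N`, subtraction-free). -/
theorem two_mul_sum_card_powerset : 2 * ∑ T : Finset (Fin N), T.card = N * 2 ^ N := by
  classical
  have h1 : ∑ T : Finset (Fin N), T.card = ∑ T : Finset (Fin N), Tᶜ.card :=
    Fintype.sum_equiv (Equiv.mk (fun T : Finset (Fin N) => Tᶜ) (fun T => Tᶜ) (fun T => compl_compl T) (fun T => compl_compl T)) _ _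
      fun T => by simp only [Equiv.coe_fn_mk, compl_compl]
  have h2 : ∑ T : Finset (Fin N), (T.card + Tᶜ.card) = N * 2 ^ N := by
    rw [sum_congr rfl fun T _ => card_add_card_compl T, sum_const, card_univ, Fintype.card_finset, Fintype.card_fin, smul_eq_mul, mul_comm]
  rw [two_mul]
  conv_lhs => arg 2; rw [h1]
  rw [← sum_add_distrib, h2]

/-- **F1(c), degree form: `S(V ∖ Y) + N·|Y| = S(Y) + N·2^{N−1}`**, written as `2·S(Yᶜ) + 2N|Y| = 2·S(Y) + N·2^N`. -/
theorem oshS_compl (Y : Finset (V N)) : 2 * oshS Yᶜ + 2 * (N * Y.card) = 2 * oshS Y + N * 2 ^ N := by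
  classical
  -- `S(Yᶜ) = Σ_{T : Tᶜ ∉ osh Y} |T| = Σ_T |T| − Σ_{S ∈ osh Y} (N − |S|)`
  have hstd : ∀ T : Finset (Fin N), (if colexStd Yᶜ T then T.card else 0) + (if colexStd Y Tᶜ then T.card else 0) = T.card := by
    intro T
    rw [colexStd_compl]
    by_cases h : colexStd Y Tᶜ <;> simp [h]
  have hsum : oshS Yᶜ + ∑ T : Finset (Fin N), (if colexStd Y Tᶜ then T.card else 0) = ∑ T : Finset (Fin N), T.card := by
    unfold oshS
    rw [← sum_add_distrib]
    exact sum_congr rfl fun T _ => hstd T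
  -- re-index the second sum by complements: `Σ_{S std} |Sᶜ| = Σ_{S std} (N − |S|)`
  have hre : ∑ T : Finset (Fin N), (if colexStd Y Tᶜ then T.card else 0) = ∑ S : Finset (Fin N), (if colexStd Y S then Sᶜ.card else 0) :=
    Fintype.sum_equiv (Equiv.mk (fun T : Finset (Fin N) => Tᶜ) (fun T => Tᶜ) (fun T => compl_compl T) (fun T => compl_compl T)) _ _
      fun T => by simp only [Equiv.coe_fn_mk, compl_compl]
  have hcnt : ∑ S : Finset (Fin N), (if colexStd Y S then Sᶜ.card else 0) + oshS Y = N * Y.card := by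
    unfold oshS
    rw [← sum_add_distrib, sum_congr rfl fun S _ => show (if colexStd Y S then Sᶜ.card else 0) + (if colexStd Y S then S.card else 0) =
      if colexStd Y S then N else 0 by
        by_cases h : colexStd Y S
        · rw [if_pos h, if_pos h, if_pos h, add_comm, card_add_card_compl, Fintype.card_fin]
        · rw [if_neg h, if_neg h, if_neg h]]
    rw [← sum_filter, sum_const, smul_eq_mul, mul_comm]
    congr 1
    rw [← oshCount_top Y]
    unfold oshCount
    congr 1
    exact filter_congr fun S _ => ⟨fun h => ⟨h, (card_le_univ S).trans (by rw [Fintype.card_fin])⟩, fun h => h.1⟩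
  have htot := two_mul_sum_card_powerset (N := N)
  rw [hre] at hsum
  omega

end Summit.PneNP.PneNP.Theorems.ClusHilbert.Osh
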